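import Literature.Combinatorics.Additive.TripleProductProperty
import Literature.Computability.AlgebraicComplexity.WreathCharDegreePowSumGeneral
import Literature.Computability.AlgebraicComplexity.CohnUmansTPPProofs
import HarnessLib

/-!
# CKSU 2005, Thm. 7.1 and Lemma 7.2 for an ARBITRARY finite group `H` (STPP ⇒ TPP in `Sym_n ⋉ Hⁿ`)

Topic `Literature/Computability/AlgebraicComplexity`; the non-abelian companion of `STPPWreathTPP.lean`
(which treats additive abelian `H` on the model `SymWreath`), on the group `PermWreath H n = Hⁿ ⋊ Sym_n`
of `WreathCharDegreePowSumGeneral.lean`.  Source: H. Cohn, R. Kleinberg, B. Szegedy, C. Umans,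
*Group-theoretic algorithms for matrix multiplication*, FOCS 2005 = arXiv:math/0511460, §7 (held text
`paper:arxiv-math_0511460`, chunks p0011 L77 – p0012 L35; FOCS Thm. 7.1 / Lemma 7.2 = arXiv Thm. 38 /
Lemma 39), read this session:

"**Theorem 7.1.** If `n` triples of subsets `Aᵢ, Bᵢ, Cᵢ ⊆ H` satisfy the simultaneous triple product
property, then the following subsets `H₁, H₂, H₃` of `G = Sym_n ⋉ Hⁿ` satisfy the triple product property:
`H₁ = {hπ : π ∈ Sym_n, hᵢ ∈ Aᵢ for each i}`, `H₂ = {hπ : … hᵢ ∈ Bᵢ …}`, `H₃ = {hπ : … hᵢ ∈ Cᵢ …}`."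
Proof as printed (for an arbitrary group `H`): the `Sym_n`-components give `π₁π₁'⁻¹π₂π₂'⁻¹π₃π₃'⁻¹ = 1`;
with `π = π₁π₁'⁻¹`, `ρ = π₁π₁'⁻¹π₂π₂'⁻¹`, coordinate `i` of the `Hⁿ`-component is a relation
`aᵢ a'ⱼ⁻¹ bⱼ b'ₖ⁻¹ cₖ c'ᵢ⁻¹ = 1` with `j = π⁻¹(i)`, `k = ρ⁻¹(i)` [our left-action bookkeeping; printed with
`π(i)`, `ρ(i)`], so "by the simultaneous triple product property, we find that `π(i) = ρ(i) = i`. Thus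
`π = ρ = 1` … Finally … `h₁ = h₁'`, `h₂ = h₂'`, and `h₃ = h₃'` because each triple `Aᵢ, Bᵢ, Cᵢ` satisfies
the triple product property."

"**Lemma 7.2.** … *Proof.* The sizes of the three subsets … are `n!∏|Aᵢ|`, `n!∏|Bᵢ|`, and `n!∏|Cᵢ|` …
Applying Theorem 1.8 we get `((n!)³ ∏ᵢ|Aᵢ||Bᵢ||Cᵢ|)^{ω/3} ≤ Σ_j c_j^ω`. By Lemma 2 the right-hand-side is at
most `(n!)^{ω−1}(Σ_k d_k^ω)ⁿ`, and then dividing both sides by `(n!)^ω` yields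
`(∏ᵢ|Aᵢ||Bᵢ||Cᵢ|)^{ω/3} ≤ (n!)^{−1} (Σ_k d_k^ω)ⁿ`."

## Results (all proved; no named fact)

* `PermWreath.stppSet A = {hπ : hᵢ ∈ Aᵢ}`, `mem_stppSet`, `card_stppSet` (`= (∏|Aᵢ|)·n!`);
* `CohnKleinbergSzegedyUmans2005_thm38_general` — **Thm. 7.1 for every group `H`** (multiplicative
  `SimultaneousTPP` of `Literature.Combinatorics.Additive`, CKSU Def. 5.1 verbatim) and
  `realizesTPP_permWreath : RealizesTPP (Sym_n ⋉ Hⁿ) (n!∏|Aᵢ|) (n!∏|Bᵢ|) (n!∏|Cᵢ|)`;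
* `CohnKleinbergSzegedyUmans2005_lemma39_weak_general` — the displayed inequality of the proof of
  Lemma 7.2 for EVERY finite group `H`: `n! · (∏ᵢ |Aᵢ||Bᵢ||Cᵢ|)^{ω/3} ≤ (Σ_k d_k^ω)ⁿ`, from the tree's
  DISCHARGED Thm. 1.8 (`CKSU2005_thm18_holds`) and Lemma 2 for arbitrary `H`
  (`CohnKleinbergSzegedyUmans2005_lemma2_omega`).  (The abelian file has `Σ d_k^ω = |H|`.)

## References

* [CohnKleinbergSzegedyUmans2005] FOCS 2005 = arXiv:math/0511460, §7: Thm. 7.1 (arXiv Thm. 38) with proof,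
  Lemma 7.2 (arXiv Lemma 39) with proof; Thm. 1.8; Lemma 2.
-/

noncomputable section

namespace Literature.Computability.AlgebraicComplexity

open Finset Literature.RepresentationTheory.FiniteGroups Literature.Combinatorics.Additive

namespace PermWreath

variable {H : Type*} [Group H] {n : ℕ}

/-- `Sym_n ⋉ Hⁿ` as a `Fintype` (as a set it is `Hⁿ × Sym_n`). [folklore] -/
instance [Fintype H] [DecidableEq H] : Fintype (PermWreath H n) :=
  Fintype.ofEquiv _ SemidirectProduct.equivProd.symm

/-! ### The three subsets `Hᵢ = {hπ : hᵢ ∈ Aᵢ}` -/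

/-- `{hπ : π ∈ Sym_n, hᵢ ∈ Aᵢ for each i} ⊆ Sym_n ⋉ Hⁿ`. [cite: CohnKleinbergSzegedyUmans2005, Thm. 7.1 (arXiv Thm. 38)] -/
def stppSet [DecidableEq H] (A : Fin n → Finset H) : Finset (PermWreath H n) :=
  (Fintype.piFinset A ×ˢ (Finset.univ : Finset (Equiv.Perm (Fin n)))).image fun p => ⟨p.1, p.2⟩

/-- Membership: `hπ ∈ H_A ↔ ∀ i, hᵢ ∈ Aᵢ`. [cite: CohnKleinbergSzegedyUmans2005, Thm. 7.1 (arXiv Thm. 38)] -/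
theorem mem_stppSet [DecidableEq H] {A : Fin n → Finset H} {w : PermWreath H n} :
    w ∈ stppSet A ↔ ∀ i, w.left i ∈ A i := by
  constructor
  · intro h
    obtain ⟨⟨f, π⟩, hp, rfl⟩ := Finset.mem_image.mp h
    exact Fintype.mem_piFinset.mp (Finset.mem_product.mp hp).1
  · intro h
    exact Finset.mem_image.mpr ⟨⟨w.left, w.right⟩,
      Finset.mem_product.mpr ⟨Fintype.mem_piFinset.mpr h, Finset.mem_univ _⟩, rfl⟩

/-- "The sizes of the three subsets of `G` in Theorem 7.1 are `n!∏|Aᵢ|`, …": `|H_A| = (∏ᵢ |Aᵢ|) · n!`.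
[cite: CohnKleinbergSzegedyUmans2005, Lemma 7.2 (arXiv Lemma 39), proof] -/
theorem card_stppSet [DecidableEq H] (A : Fin n → Finset H) :
    (stppSet A).card = (∏ i, (A i).card) * n.factorial := by
  have hinj : Function.Injective fun p : (Fin n → H) × Equiv.Perm (Fin n) =>
      (⟨p.1, p.2⟩ : PermWreath H n) := by
    rintro ⟨f, π⟩ ⟨g, σ⟩ h
    exact Prod.ext (congrArg SemidirectProduct.left h) (congrArg SemidirectProduct.right h)
  rw [stppSet, Finset.card_image_of_injective _ hinj, Finset.card_product, Fintype.card_piFinset,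
    Finset.card_univ, Fintype.card_perm, Fintype.card_fin]

/-! ### Theorem 7.1 / 38 for an arbitrary group -/

/-- The `Hⁿ`-component of a right quotient: `(s s'⁻¹)ⱼ = sⱼ (s'_{P⁻¹ j})⁻¹` with `P = π_s π_{s'}⁻¹`.
[folklore] -/
private theorem mul_inv_left_apply (s s' : PermWreath H n) (j : Fin n) :
    (s * s'⁻¹).left j = s.left j * (s'.left ((s * s'⁻¹).right⁻¹ j))⁻¹ := by
  simp [PermWreath.mul_left, SemidirectProduct.inv_left, mul_inv_rev]

/-- The `Hⁿ`-component of a triple product: `(XYZ)ᵢ = Xᵢ · Y_{P⁻¹ i} · Z_{Q⁻¹ P⁻¹ i}`. [folklore] -/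
private theorem mul_mul_left_apply (X Y Z : PermWreath H n) (i : Fin n) :
    (X * Y * Z).left i = X.left i * Y.left (X.right⁻¹ i) * Z.left (Y.right⁻¹ (X.right⁻¹ i)) := by
  simp [PermWreath.mul_left, mul_inv_rev]

/-- **Cohn–Kleinberg–Szegedy–Umans 2005, Theorem 7.1 (arXiv Thm. 38), for an ARBITRARY group `H`**: if
`(Aᵢ, Bᵢ, Cᵢ)_{i<n}` satisfy the simultaneous triple product property (CKSU Def. 5.1, the tree's
multiplicative `SimultaneousTPP`), then `H₁ = {hπ : hᵢ ∈ Aᵢ}`, `H₂`, `H₃` satisfy the triple product property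
in `Sym_n ⋉ Hⁿ`.  Proof as printed (module docstring). [cite: CohnKleinbergSzegedyUmans2005, Thm. 7.1 (arXiv Thm. 38)] -/
theorem _root_.Literature.Computability.AlgebraicComplexity.CohnKleinbergSzegedyUmans2005_thm38_general
    [DecidableEq H] {A B C : Fin n → Finset H} (hS : SimultaneousTPP A B C) :
    TripleProductProperty (stppSet A) (stppSet B) (stppSet C) := by
  intro s hs s' hs' t ht t' ht' u hu u' hu' h
  rw [mem_stppSet] at hs hs' ht ht' hu hu'
  -- the `Sym_n`-component: `P Q R = 1`
  have hPQR : (s * s'⁻¹).right * (t * t'⁻¹).right * (u * u'⁻¹).right = 1 :=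
    congrArg SemidirectProduct.right h
  set P := (s * s'⁻¹).right with hP
  set Q := (t * t'⁻¹).right with hQ
  set R := (u * u'⁻¹).right with hR
  have hRQP : ∀ i, R⁻¹ (Q⁻¹ (P⁻¹ i)) = i := fun i => by
    have e : (P * Q * R)⁻¹ = 1 := by rw [hPQR, inv_one]
    have := congrArg (fun g : Equiv.Perm (Fin n) => g i) e
    simpa [mul_inv_rev] using this
  -- the `Hⁿ`-component, coordinate by coordinate
  have hcoord : ∀ i, P⁻¹ i = i ∧ Q⁻¹ (P⁻¹ i) = i ∧ s.left i = s'.left i ∧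
      t.left i = t'.left i ∧ u.left i = u'.left i := by
    intro i
    have hL : (s * s'⁻¹ * (t * t'⁻¹) * (u * u'⁻¹)).left i = 1 := by rw [h]; rfl
    rw [mul_mul_left_apply, mul_inv_left_apply s s', mul_inv_left_apply t t',
      mul_inv_left_apply u u'] at hL
    rw [← hP, ← hQ, ← hR, hRQP i] at hL
    -- `hL : aᵢ a'ⱼ⁻¹ (bⱼ b'ₖ⁻¹) (cₖ c'ᵢ⁻¹) = 1`, `j = P⁻¹ i`, `k = Q⁻¹ P⁻¹ i`: clause (ii) of Def. 5.1
    obtain ⟨h1, h2⟩ := hS.2 i (P⁻¹ i) (Q⁻¹ (P⁻¹ i)) (s.left i) (hs i)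
      (s'.left (P⁻¹ i)) (hs' _) (t.left (P⁻¹ i)) (ht _) (t'.left (Q⁻¹ (P⁻¹ i))) (ht' _)
      (u.left (Q⁻¹ (P⁻¹ i))) (hu _) (u'.left i) (hu' i) (by simpa only [mul_assoc] using hL)
    have hb : P⁻¹ i = i := h1.symm
    have hc : Q⁻¹ (P⁻¹ i) = i := (h1.trans h2).symm
    rw [hc, hb] at hL
    -- clause (i): the triple `(Aᵢ, Bᵢ, Cᵢ)` has the triple product property
    obtain ⟨h3, h4, h5⟩ := hS.1 i (s.left i) (hs i) (s'.left i) (hs' i) (t.left i) (ht i)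
      (t'.left i) (ht' i) (u.left i) (hu i) (u'.left i) (hu' i) hL
    exact ⟨hb, hc, h3, h4, h5⟩
  -- `P = Q = R = 1`
  have hP1 : P = 1 := inv_eq_one.mp (Equiv.ext fun i => by simpa using (hcoord i).1)
  have hQ1 : Q = 1 := inv_eq_one.mp (Equiv.ext fun i => by
    have h2 := (hcoord i).2.1
    rw [(hcoord i).1] at h2
    simpa using h2)
  have hR1 : R = 1 := by rwa [hP1, hQ1, one_mul, one_mul] at hPQR
  have e1 : s.right * s'.right⁻¹ = 1 := by rw [hP] at hP1; exact hP1
  have e2 : t.right * t'.right⁻¹ = 1 := by rw [hQ] at hQ1; exact hQ1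
  have e3 : u.right * u'.right⁻¹ = 1 := by rw [hR] at hR1; exact hR1
  exact ⟨SemidirectProduct.ext (funext fun i => (hcoord i).2.2.1) (mul_inv_eq_one.mp e1),
    SemidirectProduct.ext (funext fun i => (hcoord i).2.2.2.1) (mul_inv_eq_one.mp e2),
    SemidirectProduct.ext (funext fun i => (hcoord i).2.2.2.2) (mul_inv_eq_one.mp e3)⟩

/-- **`Sym_n ⋉ Hⁿ` realizes `⟨n!∏|Aᵢ|, n!∏|Bᵢ|, n!∏|Cᵢ|⟩`** for every STPP family `(Aᵢ, Bᵢ, Cᵢ)_{i<n}` in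
ANY group `H` (Thm. 7.1 with the sizes from the proof of Lemma 7.2), in the tree's `RealizesTPP`.
[cite: CohnKleinbergSzegedyUmans2005, Thm. 7.1 (arXiv Thm. 38)] -/
theorem realizesTPP_permWreath [DecidableEq H] {A B C : Fin n → Finset H} (hS : SimultaneousTPP A B C) :
    RealizesTPP (PermWreath H n) ((∏ i, (A i).card) * n.factorial)
      ((∏ i, (B i).card) * n.factorial) ((∏ i, (C i).card) * n.factorial) :=
  ⟨stppSet A, stppSet B, stppSet C, card_stppSet A, card_stppSet B, card_stppSet C,
    CohnKleinbergSzegedyUmans2005_thm38_general hS⟩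

end PermWreath

/-! ### Lemma 7.2 / 39, displayed form, for an arbitrary finite group -/

/-- **Cohn–Kleinberg–Szegedy–Umans 2005, Lemma 7.2 (arXiv Lemma 39), proof, for an ARBITRARY finite group
`H`** with character degrees `{d_k}`: for an STPP family `(Aᵢ, Bᵢ, Cᵢ)_{i<n}`,
`n! · (∏ᵢ |Aᵢ||Bᵢ||Cᵢ|)^{ω/3} ≤ (Σ_k d_k^ω)ⁿ` — "Applying Theorem 1.8 [tree: `CKSU2005_thm18_holds`] we get
`((n!)³∏|Aᵢ||Bᵢ||Cᵢ|)^{ω/3} ≤ Σ_j c_j^ω`. By Lemma 2 [`CohnKleinbergSzegedyUmans2005_lemma2_omega`] the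
right-hand-side is at most `(n!)^{ω−1}(Σ_k d_k^ω)ⁿ`, and then dividing both sides by `(n!)^ω` …".
[cite: CohnKleinbergSzegedyUmans2005, Lemma 7.2 (arXiv Lemma 39), proof] -/
theorem CohnKleinbergSzegedyUmans2005_lemma39_weak_general {H : Type} [Group H] [Fintype H] [DecidableEq H]
    {n : ℕ} {A B C : Fin n → Finset H} (hS : SimultaneousTPP A B C) :
    (n.factorial : ℝ) * ((∏ i, ((A i).card * (B i).card * (C i).card) : ℕ) : ℝ) ^ (omega ℂ / 3) ≤
      charDegreePowSum H (omega ℂ) ^ n := by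
  have h18 := CKSU2005_thm18_holds (PermWreath H n) _ _ _ (PermWreath.realizesTPP_permWreath hS)
  have h2 := CohnKleinbergSzegedyUmans2005_lemma2_omega (H := H) n
  have h := h18.trans h2
  have hprod : (∏ i, (A i).card) * n.factorial * ((∏ i, (B i).card) * n.factorial) *
      ((∏ i, (C i).card) * n.factorial) =
      n.factorial ^ 3 * ∏ i, ((A i).card * (B i).card * (C i).card) := by
    rw [Finset.prod_mul_distrib, Finset.prod_mul_distrib]; ring
  rw [hprod] at h
  have hF : (0 : ℝ) < (n.factorial : ℝ) := by exact_mod_cast Nat.factorial_pos n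
  have hP : (0 : ℝ) ≤ ((∏ i, ((A i).card * (B i).card * (C i).card) : ℕ) : ℝ) := Nat.cast_nonneg _
  rw [Nat.cast_mul, Nat.cast_pow] at h
  generalize (n.factorial : ℝ) = F at h hF ⊢
  generalize ((∏ i, ((A i).card * (B i).card * (C i).card) : ℕ) : ℝ) = P at h hP ⊢
  generalize charDegreePowSum H (omega ℂ) ^ n = M at h ⊢
  -- `h : (F³ P)^{ω/3} ≤ F^{ω-1} M`; the left side is `F^{ω-1} (F P^{ω/3})`
  have hω : (3 : ℝ) * (omega ℂ / 3) = (omega ℂ - 1) + 1 := by ring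
  have hlhs : (F ^ 3 * P) ^ (omega ℂ / 3) = F ^ (omega ℂ - 1) * (F * P ^ (omega ℂ / 3)) := by
    rw [Real.mul_rpow (pow_nonneg hF.le 3) hP, ← Real.rpow_natCast F 3, ← Real.rpow_mul hF.le,
      Nat.cast_ofNat, hω, Real.rpow_add hF, Real.rpow_one, mul_assoc]
  rw [hlhs] at h
  exact le_of_mul_le_mul_left h (Real.rpow_pos_of_pos hF _)

end Literature.Computability.AlgebraicComplexity

end
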